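import Summits.BirchSwinnertonDyer.BirchSwinnertonDyer.Theorems.TwoAdicConverseOrdLambdaHalfAtTwoShapiroDatumDefs
import Summits.BirchSwinnertonDyer.BirchSwinnertonDyer.Theorems.TwoAdicConverseOrdLambdaHalfAtTwoPoitouTateTwoWaysAtTwo
import HarnessLib

/-!
# Route `TwoAdicConverse`, crux `OrdLambdaHalfAtTwo` (stmt-BirchSwinnertonDyer-19556), line `kato_determinant_greenberg_two`:
# pen RC-362 (B) **S2 IN THE KERNEL** — the core field `isTorsion_quot` («the Kato determinant is non-zero») is
# DERIVED from Poitou–Tate over `K_∞`, the Shapiro lattice and the per-curve torsion of `𝐇¹⧸Λz`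

Seat `bsd-2adic-conv-1` GEN 29 (cell `pub/bsd-2adic`; `--supports stmt-BirchSwinnertonDyer-19556`).  HONEST FRAMING: BSD is not proved
by any of this; the crux is NOT proved here; pure `Λ`-module algebra, no arithmetic input, nothing about any curve is asserted.

## What is proved

The v4.3 compact core `TwoAdicKatoDeterminant.PinnedKatoCore` (p679221) carries the field
`isTorsion_quot : Module.IsTorsion Λ (𝐇¹_loc ⧸ (Λ·loc zW + Λ·𝐇¹(u_A) loc zA))`, and the pen's ruling RC-362 (B) S2 asks that it be
DERIVED in the kernel rather than supplied («F3-K torsionness of `𝐇¹⧸Λz` per curve + loc_injective + rank `𝐇¹_loc = 2`; a further READING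
conjunct only if that derivation demonstrably fails»).  It does not fail, and it needs LESS than announced — neither `loc_injective` nor the
rank-`2` clause of (12.2.3):

* `isTorsion_quotient_of_le_of_forall_smul_mem` (§1, generic): for submodules `S, T ≤ M` over `Λ = ℤ_p⟦T⟧`, if `M ⧸ T` is torsion and every
  element of `T` is pushed into `S` by a non-zero-divisor, then `M ⧸ S` is torsion («an extension of torsion by torsion is torsion»; `S ≤ T`
  is the intended case but is not needed).
* `isTorsion_quotient_mapSup_of_poitouTate` (§1, generic — THE S2 LEMMA): for `locW : HW → Hl`, `locA : HA → Hl`, zeta submodules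
  `ZW ≤ HW`, `ZA ≤ HA` with `HW ⧸ ZW`, `HA ⧸ ZA` torsion (Kato Thm 12.5 (2) = the clause `IsTorsion (𝐇¹⧸Λz)` of the per-curve Literature fact
  `Kato2004.exists_zetaClass_colemanMinus_recLaw_index_two`, p681779), a lattice `L` with `c·L ≤ range(locW ⊕ locA)` for ONE non-zero-divisor `c` (the Shapiro
  lattice, `c = 2`; `range ≤ L` is not even needed), and an injective `δ : Hl ⧸ L ↪ X` into a TORSION module `X` (Poitou–Tate over `K_∞` + B2 «`X_Gr` is
  `Λ`-torsion»): `Hl ⧸ (loc ZW + loc ZA)` is torsion.  Chain: `Hl⧸L` torsion (injects into `X`) → `L ⧸ range` killed by `c` → `range ⧸ (loc ZW + loc ZA)`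
  a quotient of `HW⧸ZW × HA⧸ZA`.
* `PinnedKatoCore.isTorsion_quot_of_poitouTate` (§2): the SAME statement on the v4.3 carriers (`I_W.loc J …`, `J_A.map uA J ∘ₗ I_A.loc J_A …`,
  spans of single classes), i.e. LITERALLY the type of the field `PinnedKatoCore.isTorsion_quot`, from the fields `L`/`range_le`/`two_smul_mem`/
  `δ`/`δ_injective` of a `ShapiroKatoGreenbergDatum`-shaped package, B2, and the two per-curve torsion clauses (`range_le` unused) — so the v5 constructor
  of the core can fill `isTorsion_quot := isTorsion_quot_of_poitouTate …` and the assembled 4″ supply `⟨F3-K(W), F3-K(A), (PT), (S)⟩` needs no extra conjunct.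
* `ShapiroKatoGreenbergDatum.isTorsion_quot_eq_of_fields` (§2, transparency): for an EXISTING v4.3 datum the derived statement is the field.

References: K. Kato, Astérisque 295 (2004) Thm 12.5 (2), §17.13 [Kato2004Asterisque]; L. Washington, GTM 83 §13.2 [Washington1997];
pen RC-362 (B) (HOME/INBOX.md 2026-08-29T00:22:55Z); conv-1 GEN 28 BRIEF-19556-F3 §2 (snag S2).
-/

set_option linter.dupNamespace false
set_option autoImplicit false

noncomputable section

open scoped NumberField nonZeroDivisors
open Function WeierstrassCurve NumberField IsDedekindDomain Field CategoryTheory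
open Literature.NumberTheory.EllipticCurves Literature.NumberTheory.EllipticCurves.Kato2004
open Literature.NumberTheory.EllipticCurves.Kato2004.EulerSystemValues
open Literature.NumberTheory.GaloisRepresentations
open Summit.BirchSwinnertonDyer.BirchSwinnertonDyer.Theorems.TwoAdicPoitouTateTwoWays

namespace Summit.BirchSwinnertonDyer.BirchSwinnertonDyer.Theorems.TwoAdicKatoDeterminant

/-! ## §1 Generic `Λ`-module algebra -/

section Generic

variable (p : ℕ) [Fact p.Prime]

/-- **An extension of torsion by torsion is torsion, for quotients**: `S, T ≤ M`, `M ⧸ T` torsion, and every `y ∈ T` has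
`a • y ∈ S` for some non-zero-divisor `a` ⟹ `M ⧸ S` torsion (intended case `S ≤ T`, not needed). [cite: Washington1997, §13.2] -/
theorem isTorsion_quotient_of_le_of_forall_smul_mem {M : Type*} [AddCommGroup M] [Module (IwasawaAlgebra p) M]
    (S T : Submodule (IwasawaAlgebra p) M)
    (hT : Module.IsTorsion (IwasawaAlgebra p) (M ⧸ T))
    (hTS : ∀ y ∈ T, ∃ a : (IwasawaAlgebra p)⁰, (a : IwasawaAlgebra p) • y ∈ S) :
    Module.IsTorsion (IwasawaAlgebra p) (M ⧸ S) := by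
  intro x
  obtain ⟨m, rfl⟩ := Submodule.mkQ_surjective S x
  obtain ⟨a, ha⟩ := @hT (T.mkQ m)
  have haT : (a : IwasawaAlgebra p) • m ∈ T := by
    rw [Submonoid.smul_def, Submodule.mkQ_apply, ← Submodule.Quotient.mk_smul,
      Submodule.Quotient.mk_eq_zero] at ha
    exact ha
  obtain ⟨b, hb⟩ := hTS _ haT
  refine ⟨b * a, ?_⟩
  rw [Submonoid.smul_def, Submonoid.coe_mul, mul_smul, Submodule.mkQ_apply, ← Submodule.Quotient.mk_smul,
    ← Submodule.Quotient.mk_smul, Submodule.Quotient.mk_eq_zero]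
  exact hb

variable {HW : Type*} {HA : Type*} {Hl : Type*} {X : Type*}
  [AddCommGroup HW] [Module (IwasawaAlgebra p) HW]
  [AddCommGroup HA] [Module (IwasawaAlgebra p) HA]
  [AddCommGroup Hl] [Module (IwasawaAlgebra p) Hl]
  [AddCommGroup X] [Module (IwasawaAlgebra p) X]

/-- **S2 (pen RC-362 (B)) as `Λ`-module algebra.**  `locW : HW → Hl`, `locA : HA → Hl`, zeta submodules `ZW`, `ZA` with `HW ⧸ ZW` and
`HA ⧸ ZA` torsion, a lattice `L` with `c·L ≤ range(locW ⊕ locA)` for a non-zero-divisor `c` (`range ≤ L` is not needed), and an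
injection `δ : Hl ⧸ L ↪ X` into a torsion module: then `Hl ⧸ (loc ZW + loc ZA)` is torsion.  No injectivity of `locW ⊕ locA` and no
rank hypothesis on `Hl` is used. [cite: Kato2004Asterisque, Thm 12.5 (2) and §17.13 (shape)] [cite: Washington1997, §13.2] -/
theorem isTorsion_quotient_mapSup_of_poitouTate
    (locW : HW →ₗ[IwasawaAlgebra p] Hl) (locA : HA →ₗ[IwasawaAlgebra p] Hl)
    (ZW : Submodule (IwasawaAlgebra p) HW) (ZA : Submodule (IwasawaAlgebra p) HA)
    (hZW : Module.IsTorsion (IwasawaAlgebra p) (HW ⧸ ZW)) (hZA : Module.IsTorsion (IwasawaAlgebra p) (HA ⧸ ZA))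
    (L : Submodule (IwasawaAlgebra p) Hl)
    (c : (IwasawaAlgebra p)⁰) (hcL : ∀ y ∈ L, (c : IwasawaAlgebra p) • y ∈ LinearMap.range (locW.coprod locA))
    (δ : (Hl ⧸ L) →ₗ[IwasawaAlgebra p] X) (hδ : Injective δ) (hX : Module.IsTorsion (IwasawaAlgebra p) X) :
    Module.IsTorsion (IwasawaAlgebra p) (Hl ⧸ (ZW.map locW ⊔ ZA.map locA)) := by
  have hL : Module.IsTorsion (IwasawaAlgebra p) (Hl ⧸ L) := isTorsion_of_injective p δ hδ hX
  refine isTorsion_quotient_of_le_of_forall_smul_mem p _ L hL fun y hy ↦ ?_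
  obtain ⟨q, hwy⟩ := LinearMap.mem_range.1 (hcL y hy)
  obtain ⟨a, haW⟩ := @hZW (ZW.mkQ q.1)
  obtain ⟨a', haA⟩ := @hZA (ZA.mkQ q.2)
  have haW' : (a : IwasawaAlgebra p) • q.1 ∈ ZW := by
    rw [Submonoid.smul_def, Submodule.mkQ_apply, ← Submodule.Quotient.mk_smul, Submodule.Quotient.mk_eq_zero] at haW
    exact haW
  have haA' : (a' : IwasawaAlgebra p) • q.2 ∈ ZA := by
    rw [Submonoid.smul_def, Submodule.mkQ_apply, ← Submodule.Quotient.mk_smul, Submodule.Quotient.mk_eq_zero] at haA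
    exact haA
  refine ⟨a * a' * c, ?_⟩
  have key : ((a : IwasawaAlgebra p) * (a' : IwasawaAlgebra p) * (c : IwasawaAlgebra p)) • y =
      locW ((a' : IwasawaAlgebra p) • ((a : IwasawaAlgebra p) • q.1)) +
        locA ((a : IwasawaAlgebra p) • ((a' : IwasawaAlgebra p) • q.2)) := by
    rw [mul_smul, ← hwy, LinearMap.coprod_apply, smul_add, map_smul, map_smul, map_smul, map_smul, smul_smul, smul_smul,
      mul_comm (a' : IwasawaAlgebra p) (a : IwasawaAlgebra p)]
  rw [Submonoid.coe_mul, Submonoid.coe_mul, key]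
  exact Submodule.add_mem_sup
    (Submodule.mem_map_of_mem (ZW.smul_mem _ haW'))
    (Submodule.mem_map_of_mem (ZA.smul_mem _ haA'))

end Generic

/-! ## §2 On the v4.3 carriers: the type of `PinnedKatoCore.isTorsion_quot`, derived -/

section Carriers

variable {W : WeierstrassCurve ℚ} [W.IsElliptic] [ContinuousSMul ℤ_[2] (W.tateModule 2)]
  {A : WeierstrassCurve ℚ} [A.IsElliptic] [ContinuousSMul ℤ_[2] (A.tateModule 2)]
  {κ : ZpExtension ℚ 2} {γ : absoluteGaloisGroup ℚ}
  {I_W : IwasawaH1Data W 2 κ γ} {I_A : IwasawaH1Data A 2 κ γ}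
  {v : HeightOneSpectrum (𝓞 ℚ)} {γᵥ : absoluteGaloisGroup (v.adicCompletion ℚ)}
  {J : LocalIwasawaH1Data κ v ((tateRep W 2).toLocal v) γᵥ}
  {J' : LocalIwasawaH1Data κ v (tateLocalOrdinaryRep W 2 v) γᵥ}
  {J_A : LocalIwasawaH1Data κ v ((tateRep A 2).toLocal v) γᵥ}
  {uA : ((tateRep A 2).toLocal v).toTopRep ⟶ ((tateRep W 2).toLocal v).toTopRep}
  {hsurj : Function.Surjective
    (κ.toContinuousMonoidHom.comp (resGalOfEmb (closureEmb (K := ℚ) (v.adicCompletion ℚ))))}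
  {hγ : κ.IsTopGenerator γ}
  {hγᵥ : κ.IsTopGenerator (resGalOfEmb (closureEmb (K := ℚ) (v.adicCompletion ℚ)) γᵥ)}

/-- **`PinnedKatoCore.isTorsion_quot` DERIVED (pen RC-362 (B) S2).**  On the pinned carriers of the v4.3 core: given Kato's classes
`zW ∈ 𝐇¹_Γ(T₂W)`, `zA ∈ 𝐇¹_Γ(T₂A)` with `𝐇¹_Γ(T₂W) ⧸ Λ zW` and `𝐇¹_Γ(T₂A) ⧸ Λ zA` torsion (Kato Thm 12.5 (2); the clause
`IsTorsion (I.H ⧸ Λz)` of `Kato2004.exists_zetaClass_colemanMinus_recLaw_index_two`, once for `W`, once for `A`), a Shapiro lattice `L`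
(`2·L ≤ range(loc_W ⊕ 𝐇¹(u_A)∘loc_A)`; the companion inclusion `range ≤ L` is not used) and the Poitou–Tate injection `δ : 𝐇¹_loc ⧸ L ↪ X_Gr` with `X_Gr` torsion (B2), the
quotient `𝐇¹_loc ⧸ (Λ loc zW + Λ 𝐇¹(u_A) loc zA)` is `Λ`-torsion — verbatim the type of the core's field `isTorsion_quot`.
[cite: Kato2004Asterisque, Thm 12.5 (2), §17.13 (shape)] [cite: Washington1997, §13.2] -/
theorem PinnedKatoCore.isTorsion_quot_of_poitouTate (zW : I_W.H) (zA : I_A.H)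
    (hW : Module.IsTorsion (IwasawaAlgebra 2) (I_W.H ⧸ Submodule.span (IwasawaAlgebra 2) {zW}))
    (hA : Module.IsTorsion (IwasawaAlgebra 2) (I_A.H ⧸ Submodule.span (IwasawaAlgebra 2) {zA}))
    (L : Submodule (IwasawaAlgebra 2) J.H)
    (two_smul_mem : ∀ y ∈ L, (2 : IwasawaAlgebra 2) • y ∈
      LinearMap.range ((I_W.loc J hsurj hγ hγᵥ).coprod (J_A.map uA J ∘ₗ I_A.loc J_A hsurj hγ hγᵥ)))
    {X : Type*} [AddCommGroup X] [Module (IwasawaAlgebra 2) X]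
    (δ : (J.H ⧸ L) →ₗ[IwasawaAlgebra 2] X) (δ_injective : Injective δ)
    (hX : Module.IsTorsion (IwasawaAlgebra 2) X) :
    Module.IsTorsion (IwasawaAlgebra 2)
      (J.H ⧸ ((Submodule.span (IwasawaAlgebra 2) {zW}).map (I_W.loc J hsurj hγ hγᵥ) ⊔
        (Submodule.span (IwasawaAlgebra 2) {zA}).map (J_A.map uA J ∘ₗ I_A.loc J_A hsurj hγ hγᵥ))) := by
  have h2' : (2 : IwasawaAlgebra 2) ≠ 0 := by
    rw [← map_ofNat (PowerSeries.C (R := ℤ_[2])) 2]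
    exact (map_ne_zero_iff _ PowerSeries.C_injective).2 two_ne_zero
  have h2 : (2 : IwasawaAlgebra 2) ∈ (IwasawaAlgebra 2)⁰ := mem_nonZeroDivisors_of_ne_zero h2'
  exact isTorsion_quotient_mapSup_of_poitouTate 2 _ _ _ _ hW hA L ⟨2, h2⟩ two_smul_mem δ δ_injective hX

variable {K : Type} [Field K] [NumberField K] {κK : ZpExtension K 2} {γK : absoluteGaloisGroup K}
  {w : HeightOneSpectrum (𝓞 K)}
  {DGr : (W.baseChange K).GreenbergStrictSelmerDualData κK γK
    (Summit.BirchSwinnertonDyer.Rank1Residual.X11b.AcSelmer.bdpData (MK W K) 2 w)}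
  {Dfi : (W.baseChange K).GreenbergStrictSelmerDualData κK γK (fineData W K)}
  {L₀ L₀' : IwasawaAlgebra 2} {b b' : ℕ}

/-- **Transparency**: for an EXISTING v4.3 Shapiro datum with `X_Gr` torsion and the two per-curve torsion clauses, the derived torsion
statement is (propositionally) its field `isTorsion_quot` — the field is REDUNDANT given B2 and Kato Thm 12.5 (2) for `W` and `A`. [folklore] -/
theorem ShapiroKatoGreenbergDatum.isTorsion_quot_of_fields
    (S : ShapiroKatoGreenbergDatum I_W I_A J J' J_A uA hsurj hγ hγᵥ DGr Dfi L₀ L₀' b b')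
    (hW : Module.IsTorsion (IwasawaAlgebra 2) (I_W.H ⧸ Submodule.span (IwasawaAlgebra 2) {S.zW}))
    (hA : Module.IsTorsion (IwasawaAlgebra 2) (I_A.H ⧸ Submodule.span (IwasawaAlgebra 2) {S.zA}))
    (hX : Module.IsTorsion (IwasawaAlgebra 2) DGr.X) :
    Module.IsTorsion (IwasawaAlgebra 2) (J.H ⧸ S.toPinnedKatoCore.zetaSpan) :=
  PinnedKatoCore.isTorsion_quot_of_poitouTate S.zW S.zA hW hA S.L S.two_smul_mem S.δ S.δ_injective hX

end Carriers

end Summit.BirchSwinnertonDyer.BirchSwinnertonDyer.Theorems.TwoAdicKatoDeterminant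


/-! ## §3 (appended, conv-1 GEN 29, after crux-triage r1-1 GEN 19 Δ19-2 / PS 01:05Z) The SEMILINEAR variants — repair R-b of the
Poitou–Tate field: `δ : 𝐇¹_loc ⧸ L →ₛₗ[θ] X_Gr` for a ring automorphism `θ` of `Λ` (generator change / Iwasawa involution between the
`κ`-keyed compact side and the `κK`-keyed contragredient dual).  `Λ`-torsionness transports through an injective `θ`-SEMILINEAR map into a
torsion module (`a • δ x = 0 ⟹ δ (θ⁻¹a • x) = 0 ⟹ θ⁻¹a • x = 0`, `θ⁻¹ a ≠ 0` in the domain `Λ`), so S2 survives the re-keying verbatim. -/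

namespace Summit.BirchSwinnertonDyer.BirchSwinnertonDyer.Theorems.TwoAdicKatoDeterminant

section Semilinear

variable (p : ℕ) [Fact p.Prime]

/-- **A `Λ`-module that injects `θ`-SEMILINEARLY into a torsion `Λ`-module is torsion**, for any ring automorphism `θ` of `Λ = ℤ_p⟦T⟧`
(e.g. a generator change `T ↦ (1+T)^u − 1` or the Iwasawa involution): if `b • δ x = 0` with `b ≠ 0` then `δ (θ⁻¹ b • x) = 0`, so
`θ⁻¹ b • x = 0` and `θ⁻¹ b ≠ 0`. [cite: Washington1997, §13.2] -/
theorem isTorsion_of_injective_semilinear {A : Type*} {B : Type*}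
    [AddCommGroup A] [Module (IwasawaAlgebra p) A] [AddCommGroup B] [Module (IwasawaAlgebra p) B]
    (θ : IwasawaAlgebra p ≃+* IwasawaAlgebra p)
    (f : A →ₛₗ[(θ : IwasawaAlgebra p →+* IwasawaAlgebra p)] B) (hf : Injective f)
    (hB : Module.IsTorsion (IwasawaAlgebra p) B) : Module.IsTorsion (IwasawaAlgebra p) A := by
  intro x
  obtain ⟨b, hb⟩ := @hB (f x)
  have hb0 : (b : IwasawaAlgebra p) ≠ 0 := nonZeroDivisors.coe_ne_zero b
  have ha0 : θ.symm (b : IwasawaAlgebra p) ≠ 0 := fun h ↦ hb0 (by simpa using congrArg θ h)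
  refine ⟨⟨θ.symm b, mem_nonZeroDivisors_of_ne_zero ha0⟩, hf ?_⟩
  rw [map_zero, Submonoid.smul_def, LinearMap.map_smulₛₗ]
  change θ (θ.symm (b : IwasawaAlgebra p)) • f x = 0
  rw [RingEquiv.apply_symm_apply]
  exact hb

variable {HW : Type*} {HA : Type*} {Hl : Type*} {X : Type*}
  [AddCommGroup HW] [Module (IwasawaAlgebra p) HW]
  [AddCommGroup HA] [Module (IwasawaAlgebra p) HA]
  [AddCommGroup Hl] [Module (IwasawaAlgebra p) Hl]
  [AddCommGroup X] [Module (IwasawaAlgebra p) X]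

/-- **S2 with a `θ`-SEMILINEAR Poitou–Tate injection** (repair R-b of triage Δ19-2): as
`isTorsion_quotient_mapSup_of_poitouTate`, with `δ : Hl ⧸ L →ₛₗ[θ] X` semilinear along a ring automorphism `θ` of `Λ` instead of
`Λ`-linear.  [cite: Kato2004Asterisque, Thm 12.5 (2) and §17.13 (shape)] [cite: Washington1997, §13.2] -/
theorem isTorsion_quotient_mapSup_of_poitouTate_semilinear
    (locW : HW →ₗ[IwasawaAlgebra p] Hl) (locA : HA →ₗ[IwasawaAlgebra p] Hl)
    (ZW : Submodule (IwasawaAlgebra p) HW) (ZA : Submodule (IwasawaAlgebra p) HA)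
    (hZW : Module.IsTorsion (IwasawaAlgebra p) (HW ⧸ ZW)) (hZA : Module.IsTorsion (IwasawaAlgebra p) (HA ⧸ ZA))
    (L : Submodule (IwasawaAlgebra p) Hl)
    (c : (IwasawaAlgebra p)⁰) (hcL : ∀ y ∈ L, (c : IwasawaAlgebra p) • y ∈ LinearMap.range (locW.coprod locA))
    (θ : IwasawaAlgebra p ≃+* IwasawaAlgebra p)
    (δ : (Hl ⧸ L) →ₛₗ[(θ : IwasawaAlgebra p →+* IwasawaAlgebra p)] X) (hδ : Injective δ)
    (hX : Module.IsTorsion (IwasawaAlgebra p) X) :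
    Module.IsTorsion (IwasawaAlgebra p) (Hl ⧸ (ZW.map locW ⊔ ZA.map locA)) := by
  have hL : Module.IsTorsion (IwasawaAlgebra p) (Hl ⧸ L) := isTorsion_of_injective_semilinear p θ δ hδ hX
  -- from here on verbatim as in the linear case (only `Hl ⧸ L` torsion is used)
  refine isTorsion_quotient_of_le_of_forall_smul_mem p _ L hL fun y hy ↦ ?_
  obtain ⟨q, hwy⟩ := LinearMap.mem_range.1 (hcL y hy)
  obtain ⟨a, haW⟩ := @hZW (ZW.mkQ q.1)
  obtain ⟨a', haA⟩ := @hZA (ZA.mkQ q.2)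
  have haW' : (a : IwasawaAlgebra p) • q.1 ∈ ZW := by
    rw [Submonoid.smul_def, Submodule.mkQ_apply, ← Submodule.Quotient.mk_smul, Submodule.Quotient.mk_eq_zero] at haW
    exact haW
  have haA' : (a' : IwasawaAlgebra p) • q.2 ∈ ZA := by
    rw [Submonoid.smul_def, Submodule.mkQ_apply, ← Submodule.Quotient.mk_smul, Submodule.Quotient.mk_eq_zero] at haA
    exact haA
  refine ⟨a * a' * c, ?_⟩
  have key : ((a : IwasawaAlgebra p) * (a' : IwasawaAlgebra p) * (c : IwasawaAlgebra p)) • y =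
      locW ((a' : IwasawaAlgebra p) • ((a : IwasawaAlgebra p) • q.1)) +
        locA ((a : IwasawaAlgebra p) • ((a' : IwasawaAlgebra p) • q.2)) := by
    rw [mul_smul, ← hwy, LinearMap.coprod_apply, smul_add, map_smul, map_smul, map_smul, map_smul, smul_smul, smul_smul,
      mul_comm (a' : IwasawaAlgebra p) (a : IwasawaAlgebra p)]
  rw [Submonoid.coe_mul, Submonoid.coe_mul, key]
  exact Submodule.add_mem_sup
    (Submodule.mem_map_of_mem (ZW.smul_mem _ haW'))
    (Submodule.mem_map_of_mem (ZA.smul_mem _ haA'))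

end Semilinear

section CarriersSemilinear

variable {W : WeierstrassCurve ℚ} [W.IsElliptic] [ContinuousSMul ℤ_[2] (W.tateModule 2)]
  {A : WeierstrassCurve ℚ} [A.IsElliptic] [ContinuousSMul ℤ_[2] (A.tateModule 2)]
  {κ : ZpExtension ℚ 2} {γ : absoluteGaloisGroup ℚ}
  {I_W : IwasawaH1Data W 2 κ γ} {I_A : IwasawaH1Data A 2 κ γ}
  {v : HeightOneSpectrum (𝓞 ℚ)} {γᵥ : absoluteGaloisGroup (v.adicCompletion ℚ)}
  {J : LocalIwasawaH1Data κ v ((tateRep W 2).toLocal v) γᵥ}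
  {J_A : LocalIwasawaH1Data κ v ((tateRep A 2).toLocal v) γᵥ}
  {uA : ((tateRep A 2).toLocal v).toTopRep ⟶ ((tateRep W 2).toLocal v).toTopRep}
  {hsurj : Function.Surjective
    (κ.toContinuousMonoidHom.comp (resGalOfEmb (closureEmb (K := ℚ) (v.adicCompletion ℚ))))}
  {hγ : κ.IsTopGenerator γ}
  {hγᵥ : κ.IsTopGenerator (resGalOfEmb (closureEmb (K := ℚ) (v.adicCompletion ℚ)) γᵥ)}

/-- **`PinnedKatoCore.isTorsion_quot` DERIVED, re-keyed version (triage Δ19-2 repair R-b)**: as `PinnedKatoCore.isTorsion_quot_of_poitouTate`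
with the Poitou–Tate injection `δ : 𝐇¹_loc ⧸ L →ₛₗ[θ] X_Gr` SEMILINEAR along a ring automorphism `θ` of `Λ` (the generator change between the
`κ`-keyed `𝐇¹_loc` and the `κK`-keyed dual `X_Gr`).  Conclusion verbatim the type of the core's field `isTorsion_quot`.
[cite: Kato2004Asterisque, Thm 12.5 (2), §17.13 (shape)] [cite: Washington1997, §13.2] -/
theorem PinnedKatoCore.isTorsion_quot_of_poitouTate_semilinear (zW : I_W.H) (zA : I_A.H)
    (hW : Module.IsTorsion (IwasawaAlgebra 2) (I_W.H ⧸ Submodule.span (IwasawaAlgebra 2) {zW}))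
    (hA : Module.IsTorsion (IwasawaAlgebra 2) (I_A.H ⧸ Submodule.span (IwasawaAlgebra 2) {zA}))
    (L : Submodule (IwasawaAlgebra 2) J.H)
    (two_smul_mem : ∀ y ∈ L, (2 : IwasawaAlgebra 2) • y ∈
      LinearMap.range ((I_W.loc J hsurj hγ hγᵥ).coprod (J_A.map uA J ∘ₗ I_A.loc J_A hsurj hγ hγᵥ)))
    {X : Type*} [AddCommGroup X] [Module (IwasawaAlgebra 2) X]
    (θ : IwasawaAlgebra 2 ≃+* IwasawaAlgebra 2)
    (δ : (J.H ⧸ L) →ₛₗ[(θ : IwasawaAlgebra 2 →+* IwasawaAlgebra 2)] X) (δ_injective : Injective δ)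
    (hX : Module.IsTorsion (IwasawaAlgebra 2) X) :
    Module.IsTorsion (IwasawaAlgebra 2)
      (J.H ⧸ ((Submodule.span (IwasawaAlgebra 2) {zW}).map (I_W.loc J hsurj hγ hγᵥ) ⊔
        (Submodule.span (IwasawaAlgebra 2) {zA}).map (J_A.map uA J ∘ₗ I_A.loc J_A hsurj hγ hγᵥ))) := by
  have h2' : (2 : IwasawaAlgebra 2) ≠ 0 := by
    rw [← map_ofNat (PowerSeries.C (R := ℤ_[2])) 2]
    exact (map_ne_zero_iff _ PowerSeries.C_injective).2 two_ne_zero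
  have h2 : (2 : IwasawaAlgebra 2) ∈ (IwasawaAlgebra 2)⁰ := mem_nonZeroDivisors_of_ne_zero h2'
  exact isTorsion_quotient_mapSup_of_poitouTate_semilinear 2 _ _ _ _ hW hA L ⟨2, h2⟩ two_smul_mem θ δ δ_injective hX

end CarriersSemilinear

end Summit.BirchSwinnertonDyer.BirchSwinnertonDyer.Theorems.TwoAdicKatoDeterminant

end
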